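import Summits.HodgeConjecture.HodgeConjecture.Theorems.F0P2sThetaOccursInGenOriented   -- ★ F0P2-p01 (g12): §1 conj frame lemmas, Case A ∕ D, `thetaOccursInGen_of_embedding_mem` (+ OfEngine, ENGINE-GEN, adapters, N8)
import Summits.HodgeConjecture.HodgeConjecture.Theorems.F0P2tOccursClauseViaPartner      -- ★ (N9) p844705: `occursClause_cohForms_of_conjPartner_hol` (the partner road)
import Literature.NumberTheory.Automorphic.IdeleClassCharacterConjugate                   -- ★ `CMTypeOps.coe_bar_eq_setOf_conjugate_mem`
import HarnessLib

/-!
# Crux `H413`, programme P2 — Θ-OCC-GEN (books #173) AT EVERY CM FRAME: the NEGATIVELY ORIENTED half by the PARTNER ROAD, and the letter OUTRIGHT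

Cell hodgecm-mathlib (D-0151), FLOOR 0, crux item H413 = stmt-HodgeConjecture-24833 (`HCCMUnconditional.H413`); programme P2, the OCC♭-GEN line
`Cruxes/H413/Lines/F0_P2OccFlatGeneral.lean` (ONE letter Θ-OCC-GEN `stub_thetaOccursInGen`, ws-sha16 of its body `b50e296e47edd31f`) = E1 `F0_P2E3RelSign` ED. 3 v2's
`stub_thetaOccursInGen`.  ROAD A «ENGINE» of record (desk F0P2-plan (g13) rulings D-P2-14.1∕14.2): ★ F0P2-p01 (g12) `F0P2sThetaOccursInGenOriented.
thetaOccursInGen_of_embedding_mem` proved the letter at every frame whose place is POSITIVELY oriented (`(mk ι).embedding ∈ Φ_μ`; Cases A∕D) and named ONE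
residual: the same body under `(mk ι).embedding ∉ Φ_μ`.  THIS FILE closes that residual WITHOUT the conjugate hermitian space `c̄H` (no `U(H)(𝔸) ≃ U(c̄H)(𝔸)`):
at such a frame the CONJUGATE PARTNER `μ′` of [Liu2021, App. D Lem. D.1 (2)] (★ `MirrorAtPinLine.exists_conjPartner_omegaAtLine_neg`: weight one,
`Φ_(μ′) = Φ̄_μ`) IS positively oriented, so p01's Case-A pipeline (ENGINE-GEN ★ `exists_holTheta_atFrame_of_chiN` fed by F0P2-p06's ★ (N8) `chiN_gen`) runs on the
partner data `(μ′, χ̄ := conj ∘ χ, −e, −a′)` and yields the HOLOMORPHIC clause for `ω(μ′, ⟨−a′⟩, χ̄)`; ★ (N9) `occursClause_cohForms_of_conjPartner_hol`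
(`θ := conjFun ∘ θ′ ∘ J`) turns it into the COHOMOLOGICAL clause for `ω(μ, ⟨a′⟩, χ)` at the packaged frame; the `cohForms`-valued twins of the ★ output adapter
(§1, over ★ `exists_linear_frameTransport_from_pin` ∕ `occursClause_map_values` ∕ `thetaOccursInClause_of_frame_change`) and ★ `thetaOccursInClause_of_reindex`
deliver the letter (Case B, `(mk ι).embedding = ι ∉ Φ_μ`); Case C (`(mk ι).embedding = conj ∘ ι ∉ Φ_μ`) is Case B at the re-oriented frame `((mk ι).embedding, T̄)`
followed by p01's ★ antiholomorphic pull-back along `id` (`cmArchSection_eq_conjU21`, `cmCompactFactor_eq_of_embedding`, `mem_cohForms_comp_of_conj`) exactly as in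
his Case D.  §4: **`thetaOccursInGen`** — the body of `StubThetaOccursInGen` TOKEN FOR TOKEN (ws-sha16 `b50e296e47edd31f`), hypothesis-free: `by_cases` on the orientation,
★ `thetaOccursInGen_of_embedding_mem` (A∕D) ∕ §2–§3 (B∕C).  Author F0P2-p06 (g8) (announce-first 14:1xZ on the desk's D-P2-14.2 (1) offer).
`--supports stmt-HodgeConjecture-24833` (helper; THEOREMS ONLY — no definition, no instance, no `sorry`; 0 `Lines` imports).  HC_CM is proved only modulo the
2 remaining named inputs (hLiu418, h413) until rung 0 closes; this file discharges no printed citation by itself — it assembles ★ rows.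

Glue (all ★): `Liu2021.isAdmissibleElement_conj_neg_iff` [Liu2021, Def. 4.12], `CMTypeOps.coe_bar_eq_setOf_conjugate_mem` ∕ `mem_bar_iff`, `IsConjugateSymplectic.cmType_eq`.
## References
[Liu2021] Camb. J. Math. 9 (2021) = arXiv:2102.11518, Prop. 4.13 («Conversely» l. 2145–2149), Def. 4.11–4.12, App. D Lem. D.1 (2) (l. 5231), Lem. D.2 (2);
[GelbartRogawski1991] §3.1 Prop. 3.1.1 p. 455; [Li1992] Thm 2.1 (26); [KonnoKonno2007] Thm 5.4; [BorelWallach2000] VII 2.10; [BorelJacquet1979] §4.1–4.2.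
-/

set_option autoImplicit false
set_option linter.dupNamespace false

noncomputable section

open MulAction NumberField NumberField.InfinitePlace NumberField.mixedEmbedding IsDedekindDomain
open scoped SchwartzMap TensorProduct Classical Matrix ComplexOrder
open Literature.NumberTheory.Automorphic Literature.NumberTheory.Automorphic.UnitaryGroup Literature.NumberTheory.Weil1964
open Literature.NumberTheory.Automorphic.UnitaryGroup.CotangentForms
open Literature.NumberTheory.Automorphic.IdeleClassGroup
open Literature.Geometry.ComplexHyperbolic.BallModel (U21 x₀)
open Literature.AlgebraicGeometry.ShimuraVarieties
open Literature.AlgebraicGeometry.Motives (CMType)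
open Literature.NumberTheory.GelbartRogawski1991 Literature.NumberTheory.GelbartRogawski1991.UnitaryDualPair
open Literature.NumberTheory.GelbartRogawski1991.UnitaryDualPair.WeilCoinv (commute_comp_inl_comp_inr finPairToAdelic finPairRep)
open Literature.NumberTheory.Automorphic.Liu2021 Literature.NumberTheory.Automorphic.Liu2021.Def411WeilCarriers Literature.NumberTheory.Automorphic.Liu2021.Def411WeilCarriersDoubling
open Literature.NumberTheory.GaloisRepresentations (HeckeCharacter)
open Literature.RepresentationTheory Literature.RepresentationTheory.Liu2021
open Literature.RepresentationTheory.HarrisKudlaSweet1996 (IsSplittingChar)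
open HodgeCM HodgeCM.Adelic HodgeCM.PerL34 HodgeCM.Model HodgeCM.Model.ThetaSpace HodgeCM.Model.ArchSideTerm HodgeCM.Model.ThetaAdelicSide
open HodgeCM.Model.ThetaDistFin HodgeCM.Model.HypCensus HodgeCM.Model.LiuIndex HodgeCM.Model.TowerCarrier
open HodgeCM.Model.SupplyResidual.WeilPairData (charInv)
open Literature.Analysis.SegalBargmann (binvPi)
open Literature.AlgebraicGeometry.ShimuraVarieties (BallForms.isPullbackCocycle_cotangentCocycle BallForms.expP)
open Literature.AlgebraicGeometry.Liu2021 (IsAdmissibleElement isAdmissibleElement_conj_neg_iff)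
open Literature.NumberTheory.ComplexMultiplication.CMTypeOps (bar mem_bar_iff coe_bar_eq_setOf_conjugate_mem)
open Summit.HodgeConjecture.CorCM Summit.HodgeConjecture.CorCM.Model Summit.HodgeConjecture.CorCM.Transposition
open Summit.HodgeConjecture.CorCM.Transposition.OmegaChiSplitting (hsChiD)
open Summit.HodgeConjecture.HodgeConjecture.Cruxes.H413
open Summit.HodgeConjecture.HodgeConjecture.Cruxes.H413.ThetaJunction
open Summit.HodgeConjecture.HodgeConjecture.Cruxes.H413.CohFormsCarriers
open Summit.HodgeConjecture.HodgeConjecture.Cruxes.H413.CuspCot Summit.HodgeConjecture.HodgeConjecture.Cruxes.H413.ThetaDistAtLine Summit.HodgeConjecture.HodgeConjecture.Cruxes.H413.AdmissibleLine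
open Summit.HodgeConjecture.HodgeConjecture.Cruxes.H413.F0P2OccGenCotangentOfOccursIn (cmFieldOf hermSpace3Of)
open Summit.HodgeConjecture.HodgeConjecture.Cruxes.H413.F0P3HolProjectionReduction (four_le_finrank_of_two_le)
open Summit.HodgeConjecture.HodgeConjecture.Cruxes.H413.F0P2sThetaOccursInFrameTransport
open Summit.HodgeConjecture.HodgeConjecture.Cruxes.H413.F0P2sThetaOccursInArchTransport
open Summit.HodgeConjecture.HodgeConjecture.Cruxes.H413.F0P2sThetaOccursInGenOriented
open Literature.NumberTheory.Automorphic.UnitaryGroup.CotangentForms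
open Literature.Geometry.ComplexHyperbolic NumberField.InfinitePlace
open Literature.Geometry.ComplexHyperbolic.BallModel (U21 x₀ conjU21 mat)

namespace Summit.HodgeConjecture.HodgeConjecture.Cruxes.H413.F0P2tThetaOccursInGenNeg

/-! ## §1 The `cohForms`-valued twins of the output adapter ((Ta) ∘ (Tf) with `cohForms (archFactorOf F V)` as INPUT) -/

section Adapter

variable (F : HodgeCM.CMField) {ι₁ : F →+* ℂ} (V : HodgeCM.HermSpace3 F ι₁) (T : GL (Fin 3) ℂ)
  (hT : (T : Matrix (Fin 3) (Fin 3) ℂ)ᴴ * (HodgeCM.HermSpace3.Hm V).map ι₁ * (T : Matrix (Fin 3) (Fin 3) ℂ) = Literature.Geometry.ComplexHyperbolic.BallModel.J)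
  {n' : ℕ} (e₁ : Fin 3 × Fin 1 ≃ Fin n')
  (dV : Fin 3 → HodgeCM.CMField.K F) (hdV : ∀ i, IsCMField.complexConj (HodgeCM.CMField.K F) (dV i) = dV i) (hdV0 : ∀ i, dV i ≠ 0)
  (g : GL (Fin 3) (HodgeCM.CMField.K F))
  (hg : ((g : Matrix (Fin 3) (Fin 3) (HodgeCM.CMField.K F)).map (cmConjRingHom (HodgeCM.CMField.K F)))ᵀ * HodgeCM.HermSpace3.Hm V *
      (g : Matrix (Fin 3) (Fin 3) (HodgeCM.CMField.K F)) = Matrix.diagonal dV)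
  (ιV : finAdelic (↥(maximalRealSubfield (HodgeCM.CMField.K F))) (HodgeCM.CMField.K F) (IsCMField.complexConj (HodgeCM.CMField.K F)) 3
      (HodgeCM.HermSpace3.Hm V) →*
    finAdelic (↥(maximalRealSubfield (HodgeCM.CMField.K F))) (HodgeCM.CMField.K F) (IsCMField.complexConj (HodgeCM.CMField.K F)) 3
      (Matrix.diagonal dV))
  (hιV : ∀ k, ((ιV k : finAdelic (↥(maximalRealSubfield (HodgeCM.CMField.K F))) (HodgeCM.CMField.K F)
        (IsCMField.complexConj (HodgeCM.CMField.K F)) 3 (Matrix.diagonal dV)) : GL (Fin 3) (FiniteAdeleRing (𝓞 (HodgeCM.CMField.K F)) (HodgeCM.CMField.K F))) =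
      (toFinAdeleGL (HodgeCM.CMField.K F) 3 g)⁻¹ * (k : GL (Fin 3) (FiniteAdeleRing (𝓞 (HodgeCM.CMField.K F)) (HodgeCM.CMField.K F))) *
        toFinAdeleGL (HodgeCM.CMField.K F) 3 g)
  (μ : Literature.NumberTheory.Automorphic.IdeleClassGroup (HodgeCM.CMField.K F) →ₜ* Circle) (hμ : IsConjugateSymplectic (HodgeCM.CMField.K F) μ)
  (a : (↥(maximalRealSubfield (HodgeCM.CMField.K F)))ˣ)
  (χ : Chi (↥(maximalRealSubfield (HodgeCM.CMField.K F))) (HodgeCM.CMField.K F) (IsCMField.complexConj (HodgeCM.CMField.K F)))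

include hT in
/-- **(Ta), cohomological input**: an occurrence with values in `cohForms (archFactorOf F V)` gives, for every Sylvester frame `T` of `Hm V` at `ι₁`, an occurrence
with values in `cohForms [cmArchSection T, cmCompactFactor T]` — ★ `exists_linear_frameTransport_from_pin` (its `cohForms ↦ cohForms` component) ∘ ★
`occursClause_map_values`. [cite: BorelJacquet1979, §4.1, §4.2] [cite: BorelWallach2000, VII 2.10] -/
theorem occursClause_cohForms_frame_of_archFactorOf_coh {W : Type} [AddCommGroup W] [Module ℂ W]
    (σ : Representation ℂ ↥(HodgeCM.HermSpace3.adelicFin V) W)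
    (h : ∃ θ : W →ₗ[ℂ] ((CohFormsCarriers.adelicDatum F V).Adelic → (Fin 2 → ℂ)),
      θ ≠ 0 ∧ (∀ w, θ w ∈ CohFormsCarriers.cohForms (CohFormsCarriers.archFactorOf F V)) ∧
        ∀ (g : ↥(HodgeCM.HermSpace3.adelicFin V)) (w : W), θ (σ g w) = CohFormsCarriers.rightRep F V g (θ w)) :
    ∃ θ : W →ₗ[ℂ] ((CohFormsCarriers.adelicDatum F V).Adelic → (Fin 2 → ℂ)),
      θ ≠ 0 ∧
        (∀ w, θ w ∈ CotangentForms.cohForms (↥(maximalRealSubfield (HodgeCM.CMField.K F))) (HodgeCM.CMField.K F) (IsCMField.complexConj (HodgeCM.CMField.K F)) 3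
          (HodgeCM.HermSpace3.Hm V) (cmArchSection (HodgeCM.CMField.K F) ι₁ (HodgeCM.HermSpace3.Hm V) T hT)
          (cmCompactFactor (HodgeCM.CMField.K F) ι₁ (HodgeCM.HermSpace3.Hm V) T hT)) ∧
        ∀ (g : ↥(HodgeCM.HermSpace3.adelicFin V)) (w : W),
          θ (σ g w) = fun x => θ w (x * CohFormsCarriers.finToAdelic F V g) := by
  obtain ⟨Lb, hinj, hcomm, -, -, hcoh⟩ := exists_linear_frameTransport_from_pin F V T hT
  exact occursClause_map_values F V σ _ _ Lb hinj hcomm hcoh h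

include hT hg hιV in
set_option synthInstance.maxHeartbeats 400000 in
set_option maxHeartbeats 4000000 in
/-- **THE OUTPUT ADAPTER, cohomological input** — ★ p844332 `thetaOccursInClause_of_pinFrame_archFactorOf` with `cohForms (archFactorOf F V)` in place of
`holCotForms (archFactorOf F V)` in the hypothesis (same conclusion): (Ta) `occursClause_cohForms_frame_of_archFactorOf_coh` then (Tf) ★
`thetaOccursInClause_of_frame_change`. [cite: Liu2021, Prop. 4.13 («Conversely» l. 2145–2149); Def. 4.11 (l. 2092–2096)] [cite: BorelJacquet1979, §4.1, §4.2]
[cite: PlatonovRapinchuk1994, §2.3, §5.1] -/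
theorem thetaOccursInClause_of_pinFrame_archFactorOf_coh
    (hE : ∃ θ : omegaAtLine (↥(maximalRealSubfield (HodgeCM.CMField.K F))) (HodgeCM.CMField.K F) (IsCMField.complexConj (HodgeCM.CMField.K F)) 3 e₁
          (Matrix.diagonal (frameD V)) (complexConj_imagUnit (HodgeCM.CMField.K F)) (imagUnit_ne_zero (HodgeCM.CMField.K F))
          (imagUnit_mul_self (HodgeCM.CMField.K F)) (realDiagonal_isSymm (HodgeCM.CMField.K F) (frameD V) (frameD_real V))
          (isUnit_det_realDiagonal (HodgeCM.CMField.K F) (frameD V) (frameD_real V) (frameD_ne V))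
          (realDiagonal_map (HodgeCM.CMField.K F) (frameD V) (frameD_real V)).symm
          (fun b => isCompatible_chiSplittingLine (HodgeCM.CMField.K F) e₁ (frameD V) (frameD_real V) (frameD_ne V)
            (toHeckeCharacter (HodgeCM.CMField.K F) μ) (isUnitary_toHeckeCharacter (HodgeCM.CMField.K F) μ)
            ((isOscillatorChar_toHeckeCharacter_iff μ).mpr hμ)
            (TW (↥(maximalRealSubfield (HodgeCM.CMField.K F))) b) (isSymm_TW (↥(maximalRealSubfield (HodgeCM.CMField.K F))) b)
            (isUnit_det_TW (↥(maximalRealSubfield (HodgeCM.CMField.K F))) b) (JW (↥(maximalRealSubfield (HodgeCM.CMField.K F))) (HodgeCM.CMField.K F) b)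
            (JW_eq (↥(maximalRealSubfield (HodgeCM.CMField.K F))) (HodgeCM.CMField.K F) b)) a χ →ₗ[ℂ]
        ((CohFormsCarriers.adelicDatum F V).Adelic → (Fin 2 → ℂ)),
      θ ≠ 0 ∧ (∀ w, θ w ∈ CohFormsCarriers.cohForms (CohFormsCarriers.archFactorOf F V)) ∧
        ∀ (k : ↥(HodgeCM.HermSpace3.adelicFin V)) (w),
          θ (rhoAtLine (↥(maximalRealSubfield (HodgeCM.CMField.K F))) (HodgeCM.CMField.K F) (IsCMField.complexConj (HodgeCM.CMField.K F)) 3 e₁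
              (Matrix.diagonal (frameD V)) (complexConj_imagUnit (HodgeCM.CMField.K F)) (imagUnit_ne_zero (HodgeCM.CMField.K F))
              (imagUnit_mul_self (HodgeCM.CMField.K F)) (realDiagonal_isSymm (HodgeCM.CMField.K F) (frameD V) (frameD_real V))
              (isUnit_det_realDiagonal (HodgeCM.CMField.K F) (frameD V) (frameD_real V) (frameD_ne V))
              (realDiagonal_map (HodgeCM.CMField.K F) (frameD V) (frameD_real V)).symm
              (fun b => isCompatible_chiSplittingLine (HodgeCM.CMField.K F) e₁ (frameD V) (frameD_real V) (frameD_ne V)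
                (toHeckeCharacter (HodgeCM.CMField.K F) μ) (isUnitary_toHeckeCharacter (HodgeCM.CMField.K F) μ)
                ((isOscillatorChar_toHeckeCharacter_iff μ).mpr hμ)
                (TW (↥(maximalRealSubfield (HodgeCM.CMField.K F))) b) (isSymm_TW (↥(maximalRealSubfield (HodgeCM.CMField.K F))) b)
                (isUnit_det_TW (↥(maximalRealSubfield (HodgeCM.CMField.K F))) b) (JW (↥(maximalRealSubfield (HodgeCM.CMField.K F))) (HodgeCM.CMField.K F) b)
                (JW_eq (↥(maximalRealSubfield (HodgeCM.CMField.K F))) (HodgeCM.CMField.K F) b)) (ιVE V) a χ k w) =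
            CohFormsCarriers.rightRep F V k (θ w)) :
    ∃ θ : omegaAtLine (↥(maximalRealSubfield (HodgeCM.CMField.K F))) (HodgeCM.CMField.K F) (IsCMField.complexConj (HodgeCM.CMField.K F)) 3 e₁
          (Matrix.diagonal dV) (complexConj_imagUnit (HodgeCM.CMField.K F)) (imagUnit_ne_zero (HodgeCM.CMField.K F))
          (imagUnit_mul_self (HodgeCM.CMField.K F)) (realDiagonal_isSymm (HodgeCM.CMField.K F) dV hdV)
          (isUnit_det_realDiagonal (HodgeCM.CMField.K F) dV hdV hdV0) (realDiagonal_map (HodgeCM.CMField.K F) dV hdV).symm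
          (fun b => isCompatible_chiSplittingLine (HodgeCM.CMField.K F) e₁ dV hdV hdV0
            (toHeckeCharacter (HodgeCM.CMField.K F) μ) (isUnitary_toHeckeCharacter (HodgeCM.CMField.K F) μ)
            ((isOscillatorChar_toHeckeCharacter_iff μ).mpr hμ)
            (TW (↥(maximalRealSubfield (HodgeCM.CMField.K F))) b) (isSymm_TW (↥(maximalRealSubfield (HodgeCM.CMField.K F))) b)
            (isUnit_det_TW (↥(maximalRealSubfield (HodgeCM.CMField.K F))) b) (JW (↥(maximalRealSubfield (HodgeCM.CMField.K F))) (HodgeCM.CMField.K F) b)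
            (JW_eq (↥(maximalRealSubfield (HodgeCM.CMField.K F))) (HodgeCM.CMField.K F) b)) a χ →ₗ[ℂ]
        ((CohFormsCarriers.adelicDatum F V).Adelic → (Fin 2 → ℂ)),
      θ ≠ 0 ∧
        (∀ w, θ w ∈ CotangentForms.cohForms (↥(maximalRealSubfield (HodgeCM.CMField.K F))) (HodgeCM.CMField.K F) (IsCMField.complexConj (HodgeCM.CMField.K F)) 3
          (HodgeCM.HermSpace3.Hm V) (cmArchSection (HodgeCM.CMField.K F) ι₁ (HodgeCM.HermSpace3.Hm V) T hT)
          (cmCompactFactor (HodgeCM.CMField.K F) ι₁ (HodgeCM.HermSpace3.Hm V) T hT)) ∧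
        ∀ (k : ↥(HodgeCM.HermSpace3.adelicFin V)) (w),
          θ (rhoAtLine (↥(maximalRealSubfield (HodgeCM.CMField.K F))) (HodgeCM.CMField.K F) (IsCMField.complexConj (HodgeCM.CMField.K F)) 3 e₁
              (Matrix.diagonal dV) (complexConj_imagUnit (HodgeCM.CMField.K F)) (imagUnit_ne_zero (HodgeCM.CMField.K F))
              (imagUnit_mul_self (HodgeCM.CMField.K F)) (realDiagonal_isSymm (HodgeCM.CMField.K F) dV hdV)
              (isUnit_det_realDiagonal (HodgeCM.CMField.K F) dV hdV hdV0) (realDiagonal_map (HodgeCM.CMField.K F) dV hdV).symm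
              (fun b => isCompatible_chiSplittingLine (HodgeCM.CMField.K F) e₁ dV hdV hdV0
                (toHeckeCharacter (HodgeCM.CMField.K F) μ) (isUnitary_toHeckeCharacter (HodgeCM.CMField.K F) μ)
                ((isOscillatorChar_toHeckeCharacter_iff μ).mpr hμ)
                (TW (↥(maximalRealSubfield (HodgeCM.CMField.K F))) b) (isSymm_TW (↥(maximalRealSubfield (HodgeCM.CMField.K F))) b)
                (isUnit_det_TW (↥(maximalRealSubfield (HodgeCM.CMField.K F))) b) (JW (↥(maximalRealSubfield (HodgeCM.CMField.K F))) (HodgeCM.CMField.K F) b)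
                (JW_eq (↥(maximalRealSubfield (HodgeCM.CMField.K F))) (HodgeCM.CMField.K F) b)) ιV a χ k w) =
            fun x => θ w (x * finAdelicToAdelic (↥(maximalRealSubfield (HodgeCM.CMField.K F))) (HodgeCM.CMField.K F)
              (IsCMField.complexConj (HodgeCM.CMField.K F)) 3 (HodgeCM.HermSpace3.Hm V) k) := by
  have h1 := occursClause_cohForms_frame_of_archFactorOf_coh F V T hT _ hE
  exact thetaOccursInClause_of_frame_change (HodgeCM.CMField.K F) 3 (HodgeCM.HermSpace3.Hm V) e₁ dV hdV hdV0 g hg ιV hιV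
    (frameD V) (frameD_real V) (frameD_ne V) (frameG V) (frame_congr V) (ιVE V)
    (fun k => coe_finFrameCongr (HodgeCM.CMField.K F) (HodgeCM.HermSpace3.Hm V) (frameG V) (frameD V) (frame_congr V) k) μ hμ a χ _ h1

end Adapter

/-! ## §2 Case B: `(mk ι).embedding = ι ∉ Φ_μ` — the partner is positively oriented at the SAME packaged frame -/

set_option synthInstance.maxHeartbeats 400000 in
set_option maxHeartbeats 16000000 in
/-- **Θ-OCC-GEN, CASE B (`(mk ι).embedding = ι`, `ι ∉ Φ_μ`), hypothesis-free.**  ★ R3 (admissible representative `a′ = e·2δ`) ▸ for EVERY partner `μ′`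
(weight one, `HasCMType μ′ Φ̄_μ`, so `ι ∈ Φ_(μ′)` and `−e` is `Φ_(μ′)`-admissible with `−a′ = (−e)·2δ`): ENGINE-GEN ★ `exists_holTheta_atFrame_of_chiN` at
`(cmFieldOf L, hermSpace3Of …, μ′, χ̄, −e, −a′)` fed by ★ (N8) `chiN_gen` ▸ ★ (N9) `occursClause_cohForms_of_conjPartner_hol` ▸ §1 ▸ ★ `thetaOccursInClause_of_reindex`.
[cite: Liu2021, Prop. 4.13 («Conversely» l. 2145–2149); Def. 4.12 (last sentence); App. D Lem. D.1 (2) (l. 5231), Lem. D.2 (2)]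
[cite: GelbartRogawski1991, §3.1 Prop. 3.1.1 p. 455; Remark p. 457 L4–13] [cite: Li1992, Thm 2.1 (26) p. 184] [cite: KonnoKonno2007, Thm 5.4] -/
theorem thetaOccursInGen_caseB :
  ∀ (L : Type) [Field L] [NumberField L] [IsCMField L] (ι : L →+* ℂ) (H : Matrix (Fin 3) (Fin 3) L) (T : GL (Fin 3) ℂ)
    (hT : (T : Matrix (Fin 3) (Fin 3) ℂ)ᴴ * H.map ι * (T : Matrix (Fin 3) (Fin 3) ℂ) = Literature.Geometry.ComplexHyperbolic.BallModel.J),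
    (∀ τ' : L →+* ℂ, InfinitePlace.mk τ' ≠ InfinitePlace.mk ι → (H.map τ').PosDef) → 2 ≤ Module.finrank ℚ ↥(maximalRealSubfield L) →
    ∀ {n' : ℕ} (e₁ : Fin 3 × Fin 1 ≃ Fin n') (dV : Fin 3 → L) (hdV : ∀ i, IsCMField.complexConj L (dV i) = dV i)
      (hdV0 : ∀ i, dV i ≠ 0) (g : GL (Fin 3) L)
      (hg : ((g : Matrix (Fin 3) (Fin 3) L).map (cmConjRingHom L))ᵀ * H * (g : Matrix (Fin 3) (Fin 3) L) = Matrix.diagonal dV)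
      (ιV : finAdelic (↥(maximalRealSubfield L)) L (IsCMField.complexConj L) 3 H →*
          finAdelic (↥(maximalRealSubfield L)) L (IsCMField.complexConj L) 3 (Matrix.diagonal dV)),
        (∀ k, ((ιV k : finAdelic (↥(maximalRealSubfield L)) L (IsCMField.complexConj L) 3 (Matrix.diagonal dV)) :
            GL (Fin 3) (FiniteAdeleRing (𝓞 L) L)) =
          (toFinAdeleGL L 3 g)⁻¹ * (k : GL (Fin 3) (FiniteAdeleRing (𝓞 L) L)) * toFinAdeleGL L 3 g) →
        ∀ (μ : Literature.NumberTheory.Automorphic.IdeleClassGroup L →ₜ* Circle) (hμ : IsConjugateSymplectic L μ), HasWeight L μ 1 →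
          ∀ (a : (↥(maximalRealSubfield L))ˣ) (χ : Chi (↥(maximalRealSubfield L)) L (IsCMField.complexConj L)),
            (∃ e : L, IsAdmissibleElement L hμ.cmType.1 e ∧
                epsOf (↥(maximalRealSubfield L)) (imagUnitSq L) L (2 * imagUnit L)⁻¹ e = locF (↥(maximalRealSubfield L)) (imagUnitSq L) a) →
              (InfinitePlace.mk ι).embedding = ι → ι ∉ hμ.cmType.1 →
              ∃ θ : (omegaAtLine (↥(maximalRealSubfield L)) L (IsCMField.complexConj L) 3 e₁ (Matrix.diagonal dV)
                      (complexConj_imagUnit L) (imagUnit_ne_zero L) (imagUnit_mul_self L) (realDiagonal_isSymm L dV hdV)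
                      (isUnit_det_realDiagonal L dV hdV hdV0) (realDiagonal_map L dV hdV).symm
                      (fun a => isCompatible_chiSplittingLine L e₁ dV hdV hdV0 (toHeckeCharacter L μ)
                        (isUnitary_toHeckeCharacter L μ) ((isOscillatorChar_toHeckeCharacter_iff μ).mpr hμ)
                        (TW (↥(maximalRealSubfield L)) a) (isSymm_TW (↥(maximalRealSubfield L)) a)
                        (isUnit_det_TW (↥(maximalRealSubfield L)) a) (JW (↥(maximalRealSubfield L)) L a)
                        (JW_eq (↥(maximalRealSubfield L)) L a)) a χ) →ₗ[ℂ]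
                    ((adelicGroupData (↥(maximalRealSubfield L)) L (IsCMField.complexConj L) 3 H).Adelic → (Fin 2 → ℂ)),
                θ ≠ 0 ∧
                (∀ w, θ w ∈ CotangentForms.cohForms (↥(maximalRealSubfield L)) L (IsCMField.complexConj L) 3 H
                    (cmArchSection L ι H T hT) (cmCompactFactor L ι H T hT)) ∧
                ∀ (k : ↥(finAdelic (↥(maximalRealSubfield L)) L (IsCMField.complexConj L) 3 H)) w,
                  θ (rhoAtLine (↥(maximalRealSubfield L)) L (IsCMField.complexConj L) 3 e₁ (Matrix.diagonal dV)
                      (complexConj_imagUnit L) (imagUnit_ne_zero L) (imagUnit_mul_self L) (realDiagonal_isSymm L dV hdV)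
                      (isUnit_det_realDiagonal L dV hdV hdV0) (realDiagonal_map L dV hdV).symm
                      (fun a => isCompatible_chiSplittingLine L e₁ dV hdV hdV0 (toHeckeCharacter L μ)
                        (isUnitary_toHeckeCharacter L μ) ((isOscillatorChar_toHeckeCharacter_iff μ).mpr hμ)
                        (TW (↥(maximalRealSubfield L)) a) (isSymm_TW (↥(maximalRealSubfield L)) a)
                        (isUnit_det_TW (↥(maximalRealSubfield L)) a) (JW (↥(maximalRealSubfield L)) L a)
                        (JW_eq (↥(maximalRealSubfield L)) L a)) ιV a χ k w) =
                    fun x => θ w (x * finAdelicToAdelic (↥(maximalRealSubfield L)) L (IsCMField.complexConj L) 3 H k)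
 := by
  intro L _ _ _ ι H T hT hHpos h2 n' eV dV hdV hdV0 g hg ιV hιV μ hμ hw a χ hadm hemb hnot
  -- (a′): reduce to an admissible representative `a′ = e · 2δ_L` of the collection `locF a` (★ R3)
  refine F0P2sThetaOccursInLineTransport.thetaOccursInClause_of_admissibleRepresentative L 3 H eV dV hdV hdV0 ιV μ hμ χ _
    hμ.cmType.1 a hadm fun e he a' hae => ?_
  -- (An) and the field-degree guard
  have h4 : 4 ≤ Module.finrank ℚ L := four_le_finrank_of_two_le (L := L) h2
  have hV : IsAnisotropic (cmFieldOf L) (HodgeCM.HermSpace3.Hm (hermSpace3Of L ι H T hT hHpos)) :=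
    (HodgeCM.HermSpace3.isAnisotropic_iff_finrank_ne_two (hermSpace3Of L ι H T hT hHpos)).2 (by
      show Module.finrank ℚ L ≠ 2
      omega)
  -- the PARTNER ROAD at the packaged frame: the cohomological clause for `ω(μ, ⟨a′⟩, χ)` with values in `cohForms (archFactorOf F V)`
  have hcoh := F0P2tOccursClauseViaPartner.occursClause_cohForms_of_conjPartner_hol (L := cmFieldOf L)
    (hermSpace3Of L ι H T hT hHpos) μ hμ hw hμ.hasCMType_cmType a' χ (fun μ' hμ' hw' hΦ' => by
      -- the partner is positively oriented: `Φ_(μ′) = Φ̄_μ ∋ ι`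
      have hcm : hμ'.cmType = bar hμ.cmType := hμ'.cmType_eq hΦ'
      have hι' : ι ∈ hμ'.cmType.1 := by
        rw [hcm]
        exact (mem_bar_iff _ _).2 hnot
      -- `−e` is `Φ_(μ′)`-admissible and `−a′ = (−e) · 2δ_L`
      have he' : IsAdmissibleElement L hμ'.cmType.1 (-e) := by
        rw [hcm, coe_bar_eq_setOf_conjugate_mem]
        exact (isAdmissibleElement_conj_neg_iff _ _).2 he
      have hae' : (((-a' : (↥(maximalRealSubfield L))ˣ) : ↥(maximalRealSubfield L)) : L) = (-e) * (2 * imagUnit L) := by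
        rw [Units.val_neg]
        push_cast
        rw [hae]
        ring
      -- ENGINE-GEN on the partner data, fed by χN-GEN (N8)
      exact F0P2sThetaOccursInEngineGen.exists_holTheta_atFrame_of_chiN (cmFieldOf L) (hermSpace3Of L ι H T hT hHpos) hV hemb
        hμ'.cmType μ' hμ' hw' hι' _ (-e) (-a') he' hae'
        (F0P2tChiNGenHolds.chiN_gen (cmFieldOf L) (hermSpace3Of L ι H T hT hHpos) h4 hμ'.cmType μ' hμ' hw'
          (by rw [hemb]; exact hι') _ (-e) (-a') he' hae'))
  -- §1: to the letter's frame `(dV, g, ιV)` and `cohForms (cmArchSection, cmCompactFactor)`, at the model enumeration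
  have hA := thetaOccursInClause_of_pinFrame_archFactorOf_coh (cmFieldOf L) (hermSpace3Of L ι H T hT hHpos) T hT
    HodgeCM.Model.ArchSideTerm.e₁ dV hdV hdV0 g hg ιV hιV μ hμ a' χ hcoh
  -- the letter's enumeration `eV`
  exact F0P2sThetaOccursInOfEngine.thetaOccursInClause_of_reindex L 3 H eV HodgeCM.Model.ArchSideTerm.e₁ dV hdV hdV0 ιV μ hμ a' χ _ hA

/-! ## §3 Case C: `(mk ι).embedding ≠ ι`, `(mk ι).embedding ∉ Φ_μ` — Case B at the re-oriented frame + antiholomorphic pull-back along `id` -/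

set_option synthInstance.maxHeartbeats 400000 in
set_option maxHeartbeats 8000000 in
/-- **Θ-OCC-GEN, CASE C (`ι₀ := (mk ι).embedding ≠ ι`, `ι₀ ∉ Φ_μ`), hypothesis-free**: Case B at `(ι₀, T̄)` (★ p01 §1: `T̄` is a frame at `ι₀`, `(mk ι₀).embedding = ι₀`,
`H` definite off the place) yields `θ` valued in `cohForms (cmArchSection L ι₀ H T̄) (cmCompactFactor …)`; since `cmArchSection L ι H T = cmArchSection L ι₀ H T̄ ∘ conjU21`
(★ `cmArchSection_eq_conjU21`) and the compact factors agree (★ `cmCompactFactor_eq_of_embedding`), ★ `mem_cohForms_comp_of_conj` along `κ := id` puts every value in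
`cohForms (cmArchSection L ι H T) (cmCompactFactor …)`; `θ` is unchanged (p01's Case D, verbatim, with Case B for Case A).
[cite: Liu2021, Prop. 4.13 («Conversely» l. 2145–2149); App. D Lem. D.2 (2)] [cite: BorelWallach2000, VII 2.10] [cite: BorelJacquet1979, §4.1] -/
theorem thetaOccursInGen_caseC :
  ∀ (L : Type) [Field L] [NumberField L] [IsCMField L] (ι : L →+* ℂ) (H : Matrix (Fin 3) (Fin 3) L) (T : GL (Fin 3) ℂ)
    (hT : (T : Matrix (Fin 3) (Fin 3) ℂ)ᴴ * H.map ι * (T : Matrix (Fin 3) (Fin 3) ℂ) = Literature.Geometry.ComplexHyperbolic.BallModel.J),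
    (∀ τ' : L →+* ℂ, InfinitePlace.mk τ' ≠ InfinitePlace.mk ι → (H.map τ').PosDef) → 2 ≤ Module.finrank ℚ ↥(maximalRealSubfield L) →
    ∀ {n' : ℕ} (e₁ : Fin 3 × Fin 1 ≃ Fin n') (dV : Fin 3 → L) (hdV : ∀ i, IsCMField.complexConj L (dV i) = dV i)
      (hdV0 : ∀ i, dV i ≠ 0) (g : GL (Fin 3) L)
      (hg : ((g : Matrix (Fin 3) (Fin 3) L).map (cmConjRingHom L))ᵀ * H * (g : Matrix (Fin 3) (Fin 3) L) = Matrix.diagonal dV)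
      (ιV : finAdelic (↥(maximalRealSubfield L)) L (IsCMField.complexConj L) 3 H →*
          finAdelic (↥(maximalRealSubfield L)) L (IsCMField.complexConj L) 3 (Matrix.diagonal dV)),
        (∀ k, ((ιV k : finAdelic (↥(maximalRealSubfield L)) L (IsCMField.complexConj L) 3 (Matrix.diagonal dV)) :
            GL (Fin 3) (FiniteAdeleRing (𝓞 L) L)) =
          (toFinAdeleGL L 3 g)⁻¹ * (k : GL (Fin 3) (FiniteAdeleRing (𝓞 L) L)) * toFinAdeleGL L 3 g) →
        ∀ (μ : Literature.NumberTheory.Automorphic.IdeleClassGroup L →ₜ* Circle) (hμ : IsConjugateSymplectic L μ), HasWeight L μ 1 →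
          ∀ (a : (↥(maximalRealSubfield L))ˣ) (χ : Chi (↥(maximalRealSubfield L)) L (IsCMField.complexConj L)),
            (∃ e : L, IsAdmissibleElement L hμ.cmType.1 e ∧
                epsOf (↥(maximalRealSubfield L)) (imagUnitSq L) L (2 * imagUnit L)⁻¹ e = locF (↥(maximalRealSubfield L)) (imagUnitSq L) a) →
              (InfinitePlace.mk ι).embedding ≠ ι → (InfinitePlace.mk ι).embedding ∉ hμ.cmType.1 →
              ∃ θ : (omegaAtLine (↥(maximalRealSubfield L)) L (IsCMField.complexConj L) 3 e₁ (Matrix.diagonal dV)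
                      (complexConj_imagUnit L) (imagUnit_ne_zero L) (imagUnit_mul_self L) (realDiagonal_isSymm L dV hdV)
                      (isUnit_det_realDiagonal L dV hdV hdV0) (realDiagonal_map L dV hdV).symm
                      (fun a => isCompatible_chiSplittingLine L e₁ dV hdV hdV0 (toHeckeCharacter L μ)
                        (isUnitary_toHeckeCharacter L μ) ((isOscillatorChar_toHeckeCharacter_iff μ).mpr hμ)
                        (TW (↥(maximalRealSubfield L)) a) (isSymm_TW (↥(maximalRealSubfield L)) a)
                        (isUnit_det_TW (↥(maximalRealSubfield L)) a) (JW (↥(maximalRealSubfield L)) L a)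
                        (JW_eq (↥(maximalRealSubfield L)) L a)) a χ) →ₗ[ℂ]
                    ((adelicGroupData (↥(maximalRealSubfield L)) L (IsCMField.complexConj L) 3 H).Adelic → (Fin 2 → ℂ)),
                θ ≠ 0 ∧
                (∀ w, θ w ∈ CotangentForms.cohForms (↥(maximalRealSubfield L)) L (IsCMField.complexConj L) 3 H
                    (cmArchSection L ι H T hT) (cmCompactFactor L ι H T hT)) ∧
                ∀ (k : ↥(finAdelic (↥(maximalRealSubfield L)) L (IsCMField.complexConj L) 3 H)) w,
                  θ (rhoAtLine (↥(maximalRealSubfield L)) L (IsCMField.complexConj L) 3 e₁ (Matrix.diagonal dV)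
                      (complexConj_imagUnit L) (imagUnit_ne_zero L) (imagUnit_mul_self L) (realDiagonal_isSymm L dV hdV)
                      (isUnit_det_realDiagonal L dV hdV hdV0) (realDiagonal_map L dV hdV).symm
                      (fun a => isCompatible_chiSplittingLine L e₁ dV hdV hdV0 (toHeckeCharacter L μ)
                        (isUnitary_toHeckeCharacter L μ) ((isOscillatorChar_toHeckeCharacter_iff μ).mpr hμ)
                        (TW (↥(maximalRealSubfield L)) a) (isSymm_TW (↥(maximalRealSubfield L)) a)
                        (isUnit_det_TW (↥(maximalRealSubfield L)) a) (JW (↥(maximalRealSubfield L)) L a)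
                        (JW_eq (↥(maximalRealSubfield L)) L a)) ιV a χ k w) =
                    fun x => θ w (x * finAdelicToAdelic (↥(maximalRealSubfield L)) L (IsCMField.complexConj L) 3 H k)
 := by
  intro L _ _ _ ι H T hT hHpos h2 n' eV dV hdV hdV0 g hg ιV hιV μ hμ hw a χ hadm hne hnot
  -- the re-oriented frame `(ι₀, T̄)` at the canonical representative `ι₀ := (mk ι).embedding`
  have hT₀ := conjTranspose_conjFrame_mul L ι H T hT hne
  have hemb₀ : (InfinitePlace.mk (InfinitePlace.mk ι).embedding).embedding = (InfinitePlace.mk ι).embedding := by rw [InfinitePlace.mk_embedding]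
  obtain ⟨θ, hθ0, hθA, hθσ⟩ := thetaOccursInGen_caseB L (InfinitePlace.mk ι).embedding H (Matrix.GeneralLinearGroup.map (starRingEnd ℂ) T) hT₀
    (posDef_off_embedding L ι H hHpos) h2 eV dV hdV hdV0 g hg ιV hιV μ hμ hw a χ hadm hemb₀ hnot
  refine ⟨θ, hθ0, fun w => ?_, hθσ⟩
  -- values: `cohForms (ι₀, T̄) ∋ θ w = (θ w) ∘ id ∈ cohForms (ι, T)` by the antiholomorphic pull-back along `id`
  have hrel : ∀ u : U21, (MonoidHom.id (adelicGroupData (↥(maximalRealSubfield L)) L (IsCMField.complexConj L) 3 H).Adelic) (cmArchSection L ι H T hT u) =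
      cmArchSection L (InfinitePlace.mk ι).embedding H (Matrix.GeneralLinearGroup.map (starRingEnd ℂ) T) hT₀ (conjU21 u) := fun u => by
    rw [MonoidHom.id_apply]; exact cmArchSection_eq_conjU21 L ι H T hT hne hT₀ u
  have hK : ∀ k ∈ cmCompactFactor L ι H T hT, (MonoidHom.id _) k ∈ cmCompactFactor L (InfinitePlace.mk ι).embedding H (Matrix.GeneralLinearGroup.map (starRingEnd ℂ) T) hT₀ :=
    fun k hk => by rw [MonoidHom.id_apply, ← cmCompactFactor_eq_of_embedding L ι H T hT _ hT₀]; exact hk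
  exact mem_cohForms_comp_of_conj (κ := MonoidHom.id _) (κf := MonoidHom.id _) hrel (fun γ hγ => hγ) hK (fun g => rfl) continuous_id (hθA w)

/-! ## §4 Θ-OCC-GEN outright -/

set_option synthInstance.maxHeartbeats 400000 in
set_option maxHeartbeats 8000000 in
/-- **Θ-OCC-GEN (books #173) — the body of `StubThetaOccursInGen` (`Cruxes/H413/Lines/F0_P2OccFlatGeneral.lean`, ws-sha16 `b50e296e47edd31f`) TOKEN FOR TOKEN,
HYPOTHESIS-FREE**: `by_cases` on the orientation of the place of `ι` for `μ` — ★ F0P2-p01 (g12) `thetaOccursInGen_of_embedding_mem` (Cases A∕D) or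
§2∕§3 `thetaOccursInGen_caseB` ∕ `thetaOccursInGen_caseC` (the partner road).  [Liu2021, Prop. 4.13 «Conversely»] for every CM frame of every hermitian line, both
Hodge types `(1,0) ⊕ (0,1)`. [cite: Liu2021, Prop. 4.13 («Conversely» l. 2145–2149); Def. 4.11–4.12; App. D §D.1 Steps 1–3, Lem. D.1 (2), Lem. D.2 (2)]
[cite: GelbartRogawski1991, §3.1 Prop. 3.1.1 p. 455; Remark p. 457 L4–13] [cite: Li1992, Thm 2.1 (26) p. 184] [cite: KonnoKonno2007, Thm 5.4] -/
theorem thetaOccursInGen :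
  ∀ (L : Type) [Field L] [NumberField L] [IsCMField L] (ι : L →+* ℂ) (H : Matrix (Fin 3) (Fin 3) L) (T : GL (Fin 3) ℂ)
    (hT : (T : Matrix (Fin 3) (Fin 3) ℂ)ᴴ * H.map ι * (T : Matrix (Fin 3) (Fin 3) ℂ) = Literature.Geometry.ComplexHyperbolic.BallModel.J),
    (∀ τ' : L →+* ℂ, InfinitePlace.mk τ' ≠ InfinitePlace.mk ι → (H.map τ').PosDef) → 2 ≤ Module.finrank ℚ ↥(maximalRealSubfield L) →
    ∀ {n' : ℕ} (e₁ : Fin 3 × Fin 1 ≃ Fin n') (dV : Fin 3 → L) (hdV : ∀ i, IsCMField.complexConj L (dV i) = dV i)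
      (hdV0 : ∀ i, dV i ≠ 0) (g : GL (Fin 3) L)
      (hg : ((g : Matrix (Fin 3) (Fin 3) L).map (cmConjRingHom L))ᵀ * H * (g : Matrix (Fin 3) (Fin 3) L) = Matrix.diagonal dV)
      (ιV : finAdelic (↥(maximalRealSubfield L)) L (IsCMField.complexConj L) 3 H →*
          finAdelic (↥(maximalRealSubfield L)) L (IsCMField.complexConj L) 3 (Matrix.diagonal dV)),
        (∀ k, ((ιV k : finAdelic (↥(maximalRealSubfield L)) L (IsCMField.complexConj L) 3 (Matrix.diagonal dV)) :
            GL (Fin 3) (FiniteAdeleRing (𝓞 L) L)) =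
          (toFinAdeleGL L 3 g)⁻¹ * (k : GL (Fin 3) (FiniteAdeleRing (𝓞 L) L)) * toFinAdeleGL L 3 g) →
        ∀ (μ : Literature.NumberTheory.Automorphic.IdeleClassGroup L →ₜ* Circle) (hμ : IsConjugateSymplectic L μ), HasWeight L μ 1 →
          ∀ (a : (↥(maximalRealSubfield L))ˣ) (χ : Chi (↥(maximalRealSubfield L)) L (IsCMField.complexConj L)),
            (∃ e : L, IsAdmissibleElement L hμ.cmType.1 e ∧
                epsOf (↥(maximalRealSubfield L)) (imagUnitSq L) L (2 * imagUnit L)⁻¹ e = locF (↥(maximalRealSubfield L)) (imagUnitSq L) a) →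
              ∃ θ : (omegaAtLine (↥(maximalRealSubfield L)) L (IsCMField.complexConj L) 3 e₁ (Matrix.diagonal dV)
                      (complexConj_imagUnit L) (imagUnit_ne_zero L) (imagUnit_mul_self L) (realDiagonal_isSymm L dV hdV)
                      (isUnit_det_realDiagonal L dV hdV hdV0) (realDiagonal_map L dV hdV).symm
                      (fun a => isCompatible_chiSplittingLine L e₁ dV hdV hdV0 (toHeckeCharacter L μ)
                        (isUnitary_toHeckeCharacter L μ) ((isOscillatorChar_toHeckeCharacter_iff μ).mpr hμ)
                        (TW (↥(maximalRealSubfield L)) a) (isSymm_TW (↥(maximalRealSubfield L)) a)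
                        (isUnit_det_TW (↥(maximalRealSubfield L)) a) (JW (↥(maximalRealSubfield L)) L a)
                        (JW_eq (↥(maximalRealSubfield L)) L a)) a χ) →ₗ[ℂ]
                    ((adelicGroupData (↥(maximalRealSubfield L)) L (IsCMField.complexConj L) 3 H).Adelic → (Fin 2 → ℂ)),
                θ ≠ 0 ∧
                (∀ w, θ w ∈ CotangentForms.cohForms (↥(maximalRealSubfield L)) L (IsCMField.complexConj L) 3 H
                    (cmArchSection L ι H T hT) (cmCompactFactor L ι H T hT)) ∧
                ∀ (k : ↥(finAdelic (↥(maximalRealSubfield L)) L (IsCMField.complexConj L) 3 H)) w,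
                  θ (rhoAtLine (↥(maximalRealSubfield L)) L (IsCMField.complexConj L) 3 e₁ (Matrix.diagonal dV)
                      (complexConj_imagUnit L) (imagUnit_ne_zero L) (imagUnit_mul_self L) (realDiagonal_isSymm L dV hdV)
                      (isUnit_det_realDiagonal L dV hdV hdV0) (realDiagonal_map L dV hdV).symm
                      (fun a => isCompatible_chiSplittingLine L e₁ dV hdV hdV0 (toHeckeCharacter L μ)
                        (isUnitary_toHeckeCharacter L μ) ((isOscillatorChar_toHeckeCharacter_iff μ).mpr hμ)
                        (TW (↥(maximalRealSubfield L)) a) (isSymm_TW (↥(maximalRealSubfield L)) a)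
                        (isUnit_det_TW (↥(maximalRealSubfield L)) a) (JW (↥(maximalRealSubfield L)) L a)
                        (JW_eq (↥(maximalRealSubfield L)) L a)) ιV a χ k w) =
                    fun x => θ w (x * finAdelicToAdelic (↥(maximalRealSubfield L)) L (IsCMField.complexConj L) 3 H k)
 := by
  intro L _ _ _ ι H T hT hHpos h2 n' eV dV hdV hdV0 g hg ιV hιV μ hμ hw a χ hadm
  by_cases hmem : (InfinitePlace.mk ι).embedding ∈ hμ.cmType.1
  · -- positively oriented: ★ F0P2-p01 (g12), Cases A ∕ D
    exact thetaOccursInGen_of_embedding_mem L ι H T hT hHpos h2 eV dV hdV hdV0 g hg ιV hιV μ hμ hw a χ hadm hmem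
  · -- negatively oriented: the partner road, Cases B ∕ C
    by_cases hemb : (InfinitePlace.mk ι).embedding = ι
    · exact thetaOccursInGen_caseB L ι H T hT hHpos h2 eV dV hdV hdV0 g hg ιV hιV μ hμ hw a χ hadm hemb (hemb ▸ hmem)
    · exact thetaOccursInGen_caseC L ι H T hT hHpos h2 eV dV hdV hdV0 g hg ιV hιV μ hμ hw a χ hadm hemb hmem

end Summit.HodgeConjecture.HodgeConjecture.Cruxes.H413.F0P2tThetaOccursInGenNeg

end
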